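import Literature.Probability.RandomPlanarGeometry.SelfAvoidingWalk
import Literature.Probability.RandomPlanarGeometry.SLE
import Literature.Probability.RandomPlanarGeometry.LocalMartingaleProofs
import HarnessLib

/-!
# `stub_latticeAreaLawNecessityGlue`: the lattice area law from the SAW scaling limit (glue)

Stub N3 (necessity package) of the registered skeleton of the line `boundary-area-law` for the
crux `SubseqIdentification` (stmt-CriticalPhenomena-0783, route `SAWRenewalTightness`; primary
decl `SAWParafermion.SubseqIdentification`, identical shared decl
`SAWRenewalTightness.SubseqIdentification`).

The line reduces the crux (every subsequential scaling limit of the critical `δℤ²` SAW is chordal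
SLE_{8/3}) to a dock S1 plus a LATTICE area law S4 at flat wall points; the necessity package
shows conversely that S4 follows from the conjecture `SAW.SAWScalingLimit`. This file is the pure
glue step, an implication `N1 → N2 → (SAW.SAWScalingLimit → S4)`:
* N1 (first hypothesis; the neighbour stubs `stub_sleHalfPlaneAreaLaw` and `stub_sleAreaLawGlue`
  together): the SLE_{8/3} law `μ` of a Dobrushin domain `D` with a flat horizontal window at a
  wall point `x₀ ∉ {a, b}` satisfies a two-sided `r²` law
  `c r² ≤ μ[dist(x₀, trace) < r]`, `μ[dist(x₀, trace) ≤ r] ≤ C r²` for `0 < r ≤ r₀`;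
* N2 (second hypothesis; the neighbour stub `stub_latticeAreaLawOfLimitLaw`): full weak
  convergence along `𝓝[>] 0` (bounded-continuous-test-function form) of the critical SAW laws of
  `(D; a_δ, b_δ)`, pushed to `CurveClass ℂ` by `γ ↦ γ.curve`, to a probability measure `μ` with
  that two-sided `r²` law at `x₀` gives the lattice ratio law S4 (for every fixed `0 < r ≤ ε₀`,
  eventually in `δ`, cross-multiplied against the reference radius `ε₀` in `ℝ≥0∞`);
* conclusion: under `SAW.SAWScalingLimit` (the pushed SAW laws converge in law to chordal
  SLE_{8/3}, `ConvergesInLawToSLE`), S4 holds for every `(D; a, b)` with endpoint approximation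
  `IsEndpointApprox D a b` and every flat window at `x₀ ∉ {a, b}`.

Proof (bookkeeping only). `SAW.SAWScalingLimit D a b hab` is
`ConvergesInLawToSLE (8/3) D (fun δ γ ↦ γ.curve) (fun δ ↦ SAW.law D.carrier δ (a δ) (b δ))`, i.e.
there is an SLE_{8/3} random curve `Γ` on the canonical space with
`TendstoLaw (fun δ γ ↦ γ.curve) (fun δ ↦ SAW.law …) Γ preWienerMeasure`. Its law
`μ := preWienerMeasure.map Γ` is an SLE_{8/3} law of `D` (`IsSLECurve.isSLELaw_map`) and a
probability measure (`isProbabilityMeasure_preWienerMeasure'`, `IsSLECurve.aemeasurable`,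
`Measure.isProbabilityMeasure_map`); the test-function convergence to `μ` in the form N2 wants is
`TendstoLaw` rewritten by `integral_map` (a bounded continuous `f : CurveClass ℂ →ᵇ ℝ` is
a.e.-strongly measurable for the Borel σ-algebra of the second-countable `CurveClass ℂ`). Then N1
supplies the `r²` law of `μ` and N2 the conclusion.

No named fact is used beyond the displayed hypotheses; axioms `propext`, `Classical.choice`,
`Quot.sound`.
-/

open MeasureTheory Filter Topology Set
open scoped NNReal ENNReal BoundedContinuousFunction

namespace Summit.CriticalPhenomena.SAWScalingLimit.Theorems.SubseqIdentification.BoundaryAreaLaw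

open Literature.Probability.RandomPlanarGeometry Literature.Probability.LatticeModels
open Literature.Probability.Process (preWienerMeasure)

/-- **N3 — THE LATTICE AREA LAW FROM THE SAW SCALING LIMIT (glue).**
If (N1) every SLE_{8/3} law of a Dobrushin domain with a flat horizontal window at a wall point
`x₀ ∉ {a, b}` satisfies a two-sided `r²` law for `dist(x₀, trace)`, and (N2) full weak convergence
along `𝓝[>] 0` of the pushed critical SAW laws of `(D; a_δ, b_δ)` to a probability measure with
such an `r²` law at `x₀` yields the lattice ratio law at `x₀`, then the Lawler–Schramm–Werner
conjecture `SAW.SAWScalingLimit` implies the lattice ratio law at every flat wall point of every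
Dobrushin domain with endpoint approximation: the limit law is `preWienerMeasure.map Γ` for the
SLE_{8/3} random curve `Γ` of `ConvergesInLawToSLE`, a probability measure
(`isProbabilityMeasure_preWienerMeasure'`, `Measure.isProbabilityMeasure_map`) and an SLE_{8/3}
law (`IsSLECurve.isSLELaw_map`), and `TendstoLaw` is the required test-function convergence after
`integral_map`. [folklore] -/
theorem stub_latticeAreaLawNecessityGlue :
    (∀ (D : DobrushinDomain) (μ : Measure (CurveClass ℂ)) (x₀ : ℂ) (ρ₀ : ℝ),
      IsSLELaw ((8 : ℝ≥0) / 3) D μ → 0 < ρ₀ →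
      D.carrier ∩ Metric.ball x₀ ρ₀ = {z : ℂ | x₀.im < z.im} ∩ Metric.ball x₀ ρ₀ →
      x₀ ≠ D.pt 0 → x₀ ≠ D.pt 1 →
      ∃ c C r₀ : ℝ, 0 < c ∧ 0 < C ∧ 0 < r₀ ∧ ∀ r : ℝ, 0 < r → r ≤ r₀ →
        ENNReal.ofReal (c * r ^ 2) ≤ μ {γ | Metric.infDist x₀ γ.range < r} ∧
          μ {γ | Metric.infDist x₀ γ.range ≤ r} ≤ ENNReal.ofReal (C * r ^ 2)) →
    (∀ (D : DobrushinDomain) (a b : ℝ → Site 2) (μ : Measure (CurveClass ℂ)) (x₀ : ℂ),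
      SAW.IsEndpointApprox D a b → IsProbabilityMeasure μ →
      (∀ f : CurveClass ℂ →ᵇ ℝ,
        Tendsto (fun δ => ∫ γ, f γ.curve ∂(SAW.law D.carrier δ (a δ) (b δ)))
          (𝓝[>] (0 : ℝ)) (𝓝 (∫ x, f x ∂μ))) →
      (∃ c C r₀ : ℝ, 0 < c ∧ 0 < C ∧ 0 < r₀ ∧ ∀ r : ℝ, 0 < r → r ≤ r₀ →
        ENNReal.ofReal (c * r ^ 2) ≤ μ {γ | Metric.infDist x₀ γ.range < r} ∧
          μ {γ | Metric.infDist x₀ γ.range ≤ r} ≤ ENNReal.ofReal (C * r ^ 2)) →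
      ∃ C ε₀ : ℝ, 0 < C ∧ 0 < ε₀ ∧ ∀ r : ℝ, 0 < r → r ≤ ε₀ →
        ∀ᶠ δ in 𝓝[>] (0 : ℝ),
          SAW.law D.carrier δ (a δ) (b δ) {γ | Metric.infDist x₀ γ.curve.range ≤ r} *
              ENNReal.ofReal (ε₀ ^ 2) ≤
            ENNReal.ofReal C *
              SAW.law D.carrier δ (a δ) (b δ) {γ | Metric.infDist x₀ γ.curve.range ≤ ε₀} *
                ENNReal.ofReal (r ^ 2) ∧
          SAW.law D.carrier δ (a δ) (b δ) {γ | Metric.infDist x₀ γ.curve.range ≤ ε₀} *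
              ENNReal.ofReal (r ^ 2) ≤
            ENNReal.ofReal C *
              SAW.law D.carrier δ (a δ) (b δ) {γ | Metric.infDist x₀ γ.curve.range ≤ r} *
                ENNReal.ofReal (ε₀ ^ 2)) →
    SAW.SAWScalingLimit →
    ∀ (D : DobrushinDomain) (a b : ℝ → Site 2), SAW.IsEndpointApprox D a b →
      ∀ (x₀ : ℂ) (ρ₀ : ℝ), 0 < ρ₀ →
        D.carrier ∩ Metric.ball x₀ ρ₀ = {z : ℂ | x₀.im < z.im} ∩ Metric.ball x₀ ρ₀ →
        x₀ ≠ D.pt 0 → x₀ ≠ D.pt 1 →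
        ∃ C ε₀ : ℝ, 0 < C ∧ 0 < ε₀ ∧ ∀ r : ℝ, 0 < r → r ≤ ε₀ →
          ∀ᶠ δ in 𝓝[>] (0 : ℝ),
            SAW.law D.carrier δ (a δ) (b δ) {γ | Metric.infDist x₀ γ.curve.range ≤ r} *
                ENNReal.ofReal (ε₀ ^ 2) ≤
              ENNReal.ofReal C *
                SAW.law D.carrier δ (a δ) (b δ) {γ | Metric.infDist x₀ γ.curve.range ≤ ε₀} *
                  ENNReal.ofReal (r ^ 2) ∧
            SAW.law D.carrier δ (a δ) (b δ) {γ | Metric.infDist x₀ γ.curve.range ≤ ε₀} *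
                ENNReal.ofReal (r ^ 2) ≤
              ENNReal.ofReal C *
                SAW.law D.carrier δ (a δ) (b δ) {γ | Metric.infDist x₀ γ.curve.range ≤ r} *
                  ENNReal.ofReal (ε₀ ^ 2) := by
  intro hN1 hN2 hSL D a b hab x₀ ρ₀ hρ₀ hwin hx0 hx1
  -- the SLE_{8/3} random curve `Γ` of `ConvergesInLawToSLE` and the test-function convergence
  obtain ⟨Γ, hΓ, -, hlaw⟩ := hSL D a b hab
  haveI : IsProbabilityMeasure preWienerMeasure := isProbabilityMeasure_preWienerMeasure'
  -- the limit law `μ := preWienerMeasure.map Γ` is a probability measure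
  haveI : IsProbabilityMeasure (preWienerMeasure.map Γ) :=
    Measure.isProbabilityMeasure_map hΓ.aemeasurable
  -- `TendstoLaw` in the form N2 wants (`integral_map`)
  have hconv : ∀ f : CurveClass ℂ →ᵇ ℝ,
      Tendsto (fun δ => ∫ γ, f γ.curve ∂(SAW.law D.carrier δ (a δ) (b δ))) (𝓝[>] (0 : ℝ))
        (𝓝 (∫ x, f x ∂(preWienerMeasure.map Γ))) := fun f => by
    rw [integral_map hΓ.aemeasurable f.continuous.aestronglyMeasurable]
    exact hlaw f
  exact hN2 D a b (preWienerMeasure.map Γ) x₀ hab inferInstance hconv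
    (hN1 D (preWienerMeasure.map Γ) x₀ ρ₀ hΓ.isSLELaw_map hρ₀ hwin hx0 hx1)

end Summit.CriticalPhenomena.SAWScalingLimit.Theorems.SubseqIdentification.BoundaryAreaLaw
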